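import Summits.ValiantsHypothesis.ValiantsHypothesis.Theorems.DefinabilityGapCrowdedFree
import HarnessLib

/-!
# Definability gap, ROAD P: choosing the pivot column — column loads (N1 v2 (d), first step)

Deterministic bookkeeping for the alteration stages (PLAN-N1-v2 §(5)).  The COLUMN LOAD of a
curve `c` in grid column `s` is `colLoad T c s = Σ_i #coCurves T c (i, s)`, the number of
incidences of other curves of `T` with the cells of block `c` in column `s`.

* `sum_colLoad_le`: `Σ_s colLoad T c s ≤ 2 (#T − 1)` (two curves share at most two cells,
  `DefinabilityGapPivotAdmissible.sum_card_coCurves_le`);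
* **`exists_pivotColumn`**: some column `s₀` has total load
  `m · Σ_{c ∈ T} colLoad T c s₀ ≤ 2 #T (#T − 1)` (pigeonhole) — the pivot column of the
  alteration stages;
* `mul_card_hubs_le`: at most `(Σ_c colLoad T c s₀)/λ` curves have load `≥ λ` in column `s₀`
  (the HUBS of the priority rule);
* `card_blockedRows_le_colLoad`: for any row assignment `r`, the rows `i` of block `c` whose
  column-`s₀` cell is NOT free (`s₀ ∉ freeCols T c r i`, i.e. some co-curve through it sits on
  row `i` — the rows unavailable to `c` as a pivot row, cf.
  `DefinabilityGapPhaseAExists.pivots_injective_iff`) number at most `colLoad T c s₀`.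
-/

namespace Summit.ValiantsHypothesis.ValiantsHypothesis.Theorems.DefinabilityGapPivotColumn

open Finset
open Literature.Computability.AlgebraicComplexity Literature.Computability.MetaComplexity
open Summit.ValiantsHypothesis.ValiantsHypothesis.Theorems.DefinabilityGapAffineRung
open Summit.ValiantsHypothesis.ValiantsHypothesis.Theorems.DefinabilityGapPivotAdmissible
open Summit.ValiantsHypothesis.ValiantsHypothesis.Theorems.DefinabilityGapCrowdedFree

variable {m : ℕ}

/-- The column load of `c` in column `s`: incidences of other curves of `T` with the
column-`s` cells of block `c`. [this file] -/
noncomputable def colLoad (T : Finset (Fin 3 → Fin (qOf m))) (c : Fin 3 → Fin (qOf m))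
    (s : Fin m) : ℕ :=
  ∑ i : Fin m, (coCurves T c (i, s)).card

/-- Summing the column loads over the columns gives the total load. [this file] -/
theorem sum_colLoad_eq (T : Finset (Fin 3 → Fin (qOf m))) (c : Fin 3 → Fin (qOf m)) :
    ∑ s : Fin m, colLoad T c s = ∑ p : Fin m × Fin m, (coCurves T c p).card := by
  unfold colLoad
  rw [Finset.sum_comm, Fintype.sum_prod_type]

/-- Total load `≤ 2 (#T − 1)`: two curves share at most two cells. [this file] -/
theorem sum_colLoad_le (T : Finset (Fin 3 → Fin (qOf m))) (c : Fin 3 → Fin (qOf m)) :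
    ∑ s : Fin m, colLoad T c s ≤ 2 * (T.erase c).card := by
  rw [sum_colLoad_eq]
  exact sum_card_coCurves_le T c

/-- The total load of the family over all columns is at most `2 #T (#T − 1)`. [this file] -/
theorem sum_sum_colLoad_le (T : Finset (Fin 3 → Fin (qOf m))) :
    ∑ s : Fin m, ∑ c ∈ T, colLoad T c s ≤ 2 * (T.card * (T.card - 1)) := by
  rw [Finset.sum_comm]
  calc ∑ c ∈ T, ∑ s : Fin m, colLoad T c s ≤ ∑ c ∈ T, 2 * (T.card - 1) :=
        Finset.sum_le_sum fun c hc => by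
          have h := sum_colLoad_le T c
          rw [Finset.card_erase_of_mem hc] at h
          exact h
    _ = 2 * (T.card * (T.card - 1)) := by
        rw [Finset.sum_const, smul_eq_mul]; ring

/-- **The pivot column.**  For `m ≥ 1` some column `s₀` carries at most the average total load:
`m · Σ_{c ∈ T} colLoad T c s₀ ≤ 2 #T (#T − 1)`. [this file] -/
theorem exists_pivotColumn (T : Finset (Fin 3 → Fin (qOf m))) (hm : 0 < m) :
    ∃ s₀ : Fin m, m * ∑ c ∈ T, colLoad T c s₀ ≤ 2 * (T.card * (T.card - 1)) := by
  haveI : Nonempty (Fin m) := ⟨⟨0, hm⟩⟩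
  obtain ⟨s₀, -, hs₀⟩ := Finset.exists_min_image (Finset.univ : Finset (Fin m))
    (fun s => ∑ c ∈ T, colLoad T c s) Finset.univ_nonempty
  refine ⟨s₀, le_trans ?_ (sum_sum_colLoad_le T)⟩
  calc m * ∑ c ∈ T, colLoad T c s₀ = ∑ _s : Fin m, ∑ c ∈ T, colLoad T c s₀ := by
        rw [Finset.sum_const, smul_eq_mul, Finset.card_univ, Fintype.card_fin]
    _ ≤ ∑ s : Fin m, ∑ c ∈ T, colLoad T c s :=
        Finset.sum_le_sum fun s _ => hs₀ s (Finset.mem_univ s)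

/-- **Hubs are few.**  `λ · #{c ∈ T : λ ≤ colLoad T c s} ≤ Σ_{c ∈ T} colLoad T c s`. [this file] -/
theorem mul_card_hubs_le (T : Finset (Fin 3 → Fin (qOf m))) (s : Fin m) (l : ℕ) :
    l * (T.filter fun c => l ≤ colLoad T c s).card ≤ ∑ c ∈ T, colLoad T c s := by
  classical
  calc l * (T.filter fun c => l ≤ colLoad T c s).card
      = ∑ _c ∈ T.filter (fun c => l ≤ colLoad T c s), l := by
        rw [Finset.sum_const, smul_eq_mul, mul_comm]
    _ ≤ ∑ c ∈ T.filter (fun c => l ≤ colLoad T c s), colLoad T c s :=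
        Finset.sum_le_sum fun c hc => (Finset.mem_filter.mp hc).2
    _ ≤ ∑ c ∈ T, colLoad T c s :=
        Finset.sum_le_sum_of_subset_of_nonneg (Finset.filter_subset _ _) fun _ _ _ =>
          Nat.zero_le _

/-- The BLOCKED rows of `c` for the pivot column `s₀` under `r`: rows whose column-`s₀` cell
is not free. [this file] -/
noncomputable def blockedRows (T : Finset (Fin 3 → Fin (qOf m))) (c : Fin 3 → Fin (qOf m))
    (r : (Fin 3 → Fin (qOf m)) → Fin m) (s₀ : Fin m) : Finset (Fin m) :=
  Finset.univ.filter fun i => s₀ ∉ freeCols T c r i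

/-- Membership in `blockedRows`: some co-curve through the column-`s₀` cell of row `i` sits on
row `i`. [this file] -/
theorem mem_blockedRows {T : Finset (Fin 3 → Fin (qOf m))} {c : Fin 3 → Fin (qOf m)}
    {r : (Fin 3 → Fin (qOf m)) → Fin m} {s₀ i : Fin m} :
    i ∈ blockedRows T c r s₀ ↔ ∃ c' ∈ coCurves T c (i, s₀), r c' = i := by
  unfold blockedRows
  simp only [Finset.mem_filter, Finset.mem_univ, true_and, mem_freeCols, not_forall,
    not_not, exists_prop]

/-- A blocked row has a nonempty co-curve set at its column-`s₀` cell. [this file] -/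
theorem card_coCurves_pos_of_mem_blockedRows {T : Finset (Fin 3 → Fin (qOf m))}
    {c : Fin 3 → Fin (qOf m)} {r : (Fin 3 → Fin (qOf m)) → Fin m} {s₀ i : Fin m}
    (hi : i ∈ blockedRows T c r s₀) : 1 ≤ (coCurves T c (i, s₀)).card := by
  obtain ⟨c', hc', -⟩ := mem_blockedRows.mp hi
  exact Finset.card_pos.mpr ⟨c', hc'⟩

/-- **Blocked rows are at most the column load** (for every `r`). [this file] -/
theorem card_blockedRows_le_colLoad (T : Finset (Fin 3 → Fin (qOf m))) (c : Fin 3 → Fin (qOf m))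
    (r : (Fin 3 → Fin (qOf m)) → Fin m) (s₀ : Fin m) :
    (blockedRows T c r s₀).card ≤ colLoad T c s₀ := by
  unfold colLoad
  calc (blockedRows T c r s₀).card = ∑ _i ∈ blockedRows T c r s₀, 1 := by simp
    _ ≤ ∑ i ∈ blockedRows T c r s₀, (coCurves T c (i, s₀)).card :=
        Finset.sum_le_sum fun i hi => card_coCurves_pos_of_mem_blockedRows hi
    _ ≤ ∑ i : Fin m, (coCurves T c (i, s₀)).card :=
        Finset.sum_le_sum_of_subset_of_nonneg (Finset.subset_univ _) fun _ _ _ => Nat.zero_le _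

/-- The rows AVAILABLE to `c` as a pivot row (column-`s₀` cell free) are the complement of the
blocked rows; there are at least `m − colLoad T c s₀` of them. [this file] -/
theorem le_card_availableRows (T : Finset (Fin 3 → Fin (qOf m))) (c : Fin 3 → Fin (qOf m))
    (r : (Fin 3 → Fin (qOf m)) → Fin m) (s₀ : Fin m) :
    m - colLoad T c s₀ ≤ (Finset.univ.filter fun i : Fin m => s₀ ∈ freeCols T c r i).card := by
  classical
  have h := Finset.card_filter_add_card_filter_not (s := (Finset.univ : Finset (Fin m)))
    (fun i : Fin m => s₀ ∈ freeCols T c r i)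
  rw [Finset.card_univ, Fintype.card_fin] at h
  have hb := card_blockedRows_le_colLoad T c r s₀
  unfold blockedRows at hb
  omega

end Summit.ValiantsHypothesis.ValiantsHypothesis.Theorems.DefinabilityGapPivotColumn
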